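import Mathlib
import Summits.KontsevichZagierPeriods.Zeta5Search.BigPrimeSharp
import HarnessLib

/-!
# ζ(5) search — the congruences behind the sharpness of (W∞): `W(b) ≡ 2 (mod d(b)+2)`, `U(b) ≡ 2 (mod (d(b)+2)/2)`

Cell `pub-zeta5` (HONEST FRAMING: systematic search; no irrationality claim unless certified), typer seat
generation 7.  Companion of `BigPrimeSharp.lean` (which proves `v_p(W(b)) = 0` at the prime `p = d(b)+2`): the
residue itself is the constant `2`, independently of `b` — `‖W(b) − 2‖_p ≤ p⁻¹` for `p = d(b) + 2` and
`‖U(b) − 2‖_p ≤ p⁻¹` for `2p = d(b) + 2` (`p ≥ max(5, b₀+1)`).  Mechanism: at the critical degree the power sum of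
Hasse–Taylor coefficients equals `−(−1)^r·lc(M_b) = ∓2` (`BigPrimeSharp.sum_taylor_coeff_top`), so the cleared
numerator is `≡ 2·U` modulo `p`.  Examples: `W(3;0⁷) = −22505/209952 ≡ 2 (mod 11)`, `U(4;0⁷) = 865/5971968 ≡ 2 (mod 7)`.
OUR theorem; coefficient arithmetic only.  (Filed as a separate module because the append lane to `BigPrimeSharp`
was stalled at filing time; if that append lands first this file is redundant.)
-/

noncomputable section

open Finset Polynomial

namespace Summit.KontsevichZagierPeriods.Zeta5Search.BigPrime

open Summit.KontsevichZagierPeriods.Zeta5Search.DualSeries (InBox)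
open Summit.KontsevichZagierPeriods.Zeta5Search.WedgeDictionary (coeffU coeffW coeffU_eq coeffW_eq exists_isPFData dOf)

/-- **The congruence behind the sharpness: `W(b) ≡ 2 (mod p)` at `p = d(b) + 2`** (`p ≥ max(5, b₀+1)`), stated
`p`-adically: `‖W(b) − 2‖_p ≤ p⁻¹` (e.g. `W(3;0⁷) = −22505/209952 ≡ 2 (mod 11)`). -/
theorem padicNorm_coeffW_sub_two_le (b : ℕ → ℤ) (p : ℕ) (hb : InBox b)
    (h2 : ∀ i ∈ range 7, 2 * b (i + 1) ≤ b 0) (h3 : ∑ i ∈ range 7, b (i + 1) ≤ 3 * b 0)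
    (hprime : p.Prime) (hp5 : 5 ≤ p) (hpb : b 0 + 1 ≤ (p : ℤ)) (hpd : (p : ℤ) = dOf b + 2) :
    padicNorm p (coeffW b - 2) ≤ (p : ℚ)⁻¹ := by
  haveI : Fact p.Prime := ⟨hprime⟩
  obtain ⟨e0, hS, hβ, hS3⟩ := polytope_data b hb h2 h3
  have hnp : (b 0).toNat < p := by omega
  have hpd' : p + ∑ j ∈ range 7, (b (j + 1)).toNat = 3 * (b 0).toNat + 2 := by
    have := hpd; rw [dOf, hS, e0] at this; omega
  have hhalf : ∀ j ∈ range 7, 2 * b (j + 1) ≤ b 0 + 1 := fun j hj => by have := h2 j hj; omega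
  obtain ⟨c, hc⟩ := exists_isPFData b hb (by omega)
  have hUW := Uall_mul_sum_eq b hb hhalf hc (o := 2) (by norm_num)
  rw [← coeffW_eq hc] at hUW
  have hdeg : (MF p (b 0).toNat fun j => (b (j + 1)).toNat).natDegree = 4 + (4 + 1) * (p - 1) := by
    have := natDegree_MF (p := p) hnp (by omega) (fun j => (b (j + 1)).toNat) hβ
    beta_reduce at this
    omega
  have hZ : ((Zsum (b 0).toNat (fun j => (b (j + 1)).toNat) (5 - 2) : ℤ) : ZMod p) =
      2 * ((Uall (b 0).toNat : ℤ) : ZMod p) := by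
    rw [Zsum_cast hp5 hnp _ (by norm_num : 5 - 2 < 4), sum_taylor_coeff_top _ (5 - 2 + 1) (by omega) hdeg,
      leadingCoeff_MF (by omega)]
    ring
  -- cleared form of `W − 2`: `U·(W − 2) = Z − 2U`, divisible by `p`
  have hU : ¬ (p : ℤ) ∣ Uall (b 0).toNat := not_dvd_Uall hprime hnp
  have hU0 : (Uall (b 0).toNat : ℚ) ≠ 0 := by exact_mod_cast fun h => hU (by rw [h]; exact dvd_zero _)
  have hdvd : (p : ℤ) ∣ Zsum (b 0).toNat (fun j => (b (j + 1)).toNat) (5 - 2) - 2 * Uall (b 0).toNat := by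
    rw [← ZMod.intCast_zmod_eq_zero_iff_dvd]; push_cast; rw [hZ]; ring
  have heq : coeffW b - 2 = ((Zsum (b 0).toNat (fun j => (b (j + 1)).toNat) (5 - 2) - 2 * Uall (b 0).toNat : ℤ) : ℚ) /
      (Uall (b 0).toNat : ℚ) := by
    rw [eq_div_iff hU0]; push_cast; linear_combination hUW
  rw [heq, padicNorm.div, (padicNorm.int_eq_one_iff _).2 hU, div_one, ← zpow_neg_one]
  exact (padicNorm.dvd_iff_norm_le (n := 1)).1 (by simpa using hdvd)


/-- **`U(b) ≡ 2 (mod p)` at `2p = d(b) + 2`** (`p ≥ max(5, b₀+1)`): `‖U(b) − 2‖_p ≤ p⁻¹`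
(e.g. `U(4;0⁷) = 865/5971968 ≡ 2 (mod 7)`). -/
theorem padicNorm_coeffU_sub_two_le (b : ℕ → ℤ) (p : ℕ) (hb : InBox b)
    (h2 : ∀ i ∈ range 7, 2 * b (i + 1) ≤ b 0) (h3 : ∑ i ∈ range 7, b (i + 1) ≤ 3 * b 0)
    (hprime : p.Prime) (hp5 : 5 ≤ p) (hpb : b 0 + 1 ≤ (p : ℤ)) (hpd : 2 * (p : ℤ) = dOf b + 2) :
    padicNorm p (coeffU b - 2) ≤ (p : ℚ)⁻¹ := by
  haveI : Fact p.Prime := ⟨hprime⟩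
  obtain ⟨e0, hS, hβ, hS3⟩ := polytope_data b hb h2 h3
  have hnp : (b 0).toNat < p := by omega
  have hpd' : 2 * p + ∑ j ∈ range 7, (b (j + 1)).toNat = 3 * (b 0).toNat + 2 := by
    have := hpd; rw [dOf, hS, e0] at this; omega
  have hhalf : ∀ j ∈ range 7, 2 * b (j + 1) ≤ b 0 + 1 := fun j hj => by have := h2 j hj; omega
  obtain ⟨c, hc⟩ := exists_isPFData b hb (by omega)
  have hUW := Uall_mul_sum_eq b hb hhalf hc (o := 4) (by norm_num)
  rw [← coeffU_eq hc] at hUW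
  have hdeg : (MF p (b 0).toNat fun j => (b (j + 1)).toNat).natDegree = 2 + (2 + 1) * (p - 1) := by
    have := natDegree_MF (p := p) hnp (by omega) (fun j => (b (j + 1)).toNat) hβ
    beta_reduce at this
    omega
  have hZ : ((Zsum (b 0).toNat (fun j => (b (j + 1)).toNat) (5 - 4) : ℤ) : ZMod p) =
      2 * ((Uall (b 0).toNat : ℤ) : ZMod p) := by
    rw [Zsum_cast hp5 hnp _ (by norm_num : 5 - 4 < 4), sum_taylor_coeff_top _ (5 - 4 + 1) (by omega) hdeg,
      leadingCoeff_MF (by omega)]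
    ring
  have hU : ¬ (p : ℤ) ∣ Uall (b 0).toNat := not_dvd_Uall hprime hnp
  have hU0 : (Uall (b 0).toNat : ℚ) ≠ 0 := by exact_mod_cast fun h => hU (by rw [h]; exact dvd_zero _)
  have hdvd : (p : ℤ) ∣ Zsum (b 0).toNat (fun j => (b (j + 1)).toNat) (5 - 4) - 2 * Uall (b 0).toNat := by
    rw [← ZMod.intCast_zmod_eq_zero_iff_dvd]; push_cast; rw [hZ]; ring
  have heq : coeffU b - 2 = ((Zsum (b 0).toNat (fun j => (b (j + 1)).toNat) (5 - 4) - 2 * Uall (b 0).toNat : ℤ) : ℚ) /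
      (Uall (b 0).toNat : ℚ) := by
    rw [eq_div_iff hU0]; push_cast; linear_combination hUW
  rw [heq, padicNorm.div, (padicNorm.int_eq_one_iff _).2 hU, div_one, ← zpow_neg_one]
  exact (padicNorm.dvd_iff_norm_le (n := 1)).1 (by simpa using hdvd)


end Summit.KontsevichZagierPeriods.Zeta5Search.BigPrime

end
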